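import Literature.IUT.HodgeArakelov.LabelClassesOfCuspsCor24iiYddOfCoverModelPiPM
import Literature.IUT.HodgeArakelov.LabelClassesOfCuspsCor24iiProofs
import Literature.IUT.HodgeArakelov.PlusMinusTowerCoverModelCuspFamilyPiV
import HarnessLib

/-!
# [IUTchII] Cor 2.4 (ii)(iii)′ at the genuine `±`-tower `ofCoverModel`: the ASSEMBLY over an INTERSECTION-keyed cusp datum
# (non-vacuous), and the VACUITY certificate over the containment-keyed datum

S. Mochizuki, *Inter-universal Teichmüller Theory II*, kurims manuscript (Dec. 2020), §2: Cor. 2.4 (ii) p. 70, Def. 2.3 (i)(ii)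
pp. 67–68 («the cuspidal inertia groups of `Π_⊆` may be obtained as the intersections with `Π_⊆` of those cuspidal inertia groups of
`Π_⊇` that contain a finite index subgroup that lies inside `Π_⊆`»), Rmk. 2.3.1 p. 69. [cite: Mochizuki2012, II Cor 2.4 (ii) p.70]
abc-iut cell, layer L6, node **IUTchII:Cor2.4(ii)**; seat abc-iut-w6-d069 (gen 2); abc-iut-L6-lead gen 4 §F v1.19ar GO «COR24ii-REKEY»
(«a discharged row may not rest on a vacuous universally-quantified clause»).  PROOF-ONLY (0 `def`, 0 `structure`, 0 `instance`);
sequel BY NAME to this seat's `LabelClassesOfCuspsCor24iiYddOfCoverModelPiPM.lean` (p444353: `…_of_inter_of_piTemp/_of_inter/_of_origin`,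
`isCuspidalInertia_piPM_of_containment`), abc-iut-w5-d184's assembly `cor24_ii_iii'_of_inputs` and abc-iut-w4-d005's emptiness certificate
`PlusMinusTower.isEmpty_cuspidalInertia_piV_of_containment` (p442973).

CONTENT.
* §1 `cor24_ii_iii'_ofCoverModel_of_containment` — VACUITY CERTIFICATE: over abc-iut-w5-d132's containment-keyed datum (p430433's
  characterisation `hchar`, verbatim) the typed node statement `Cor24_ii_iii' W Cu H` HOLDS FOR EVERY `H` with NO Cor-2.4 input at all,
  granted p442973's four [EtTh]-side hypotheses (h1)–(h4) — because every clause of `Cor24_ii_iii'` is `∀`-over the EMPTY `Π_v`-family.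
  So at that datum the node's typed statement carries no content (vacuously-true ≠ covered).
* §2 `cor24_ii_iii'_ofCoverModel_of_inter[_of_piTemp|_of_origin]` — the ASSEMBLY for ANY datum `Ci` obeying print's Def 2.3 (ii)
  INTERSECTION rule relative to the tempered cusp family (`hint`): `Cor24_ii_iii' W Ci H` from ⟨node Cor 2.4 (i) at `Ci` (`h24i`); (S)
  `hsurj`; (E) `hcap`; F-1704 `habs`; F-1708 `hcomm`; the cusp-splitting input (`hsplit` / registered origin inputs `hO`, `eO`)⟩ — the SAME
  residual list as the lineage's rule-(3) v2 token, now over a family that is inhabited.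
* §3 `exists_interKeyed_cuspidalInertiaData_ofCoverModel` — such a datum EXISTS on `ofCoverModel` (constructed inside the proof, no `def`):
  the `{Π_v ⊆ Π^±_v}` slice of print's recipe over the tempered cusp family — cuspidal in `Π^±_v` ⟺ a member `J`; cuspidal in `Π_v` ⟺ a
  trace `J ∩ Π_v` — with its `Π_v`-family INHABITED as soon as `X` has a cusp; and `cor24_ii_iii'_ofCoverModel_interKeyed_of_origin` packages
  §2 for it.  (Print's proviso «containing a finite index subgroup inside `Π_⊆`» is automatic for the finite-index inclusion `Π_v ⊆ Π^±_v`
  and is neither used nor proved here.)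

HONEST LIMITS: every Cor-2.4 / [SemiAnbd] / [EtTh] input is a HYPOTHESIS by name (h24i, hsurj, hcap, habs, hcomm, hsplit / hO eO, hint,
(h1)–(h4)); no new `Prop` definition; the datum of §3 is NOT an agreement of record (no `StableCurveAgreement` is built); nothing of
p430433 / p442973 / p444353 is edited.  Nothing of the series is asserted; no side is taken on [IUTchIII] Cor. 3.12; typed ≠ proved.
-/

noncomputable section

namespace Literature.IUT.HodgeArakelov

open Literature.AnabelianGeometry.EtaleTheta Literature.AnabelianGeometry.SemiGraphs
open scoped Pointwise

namespace PlusMinusTower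

variable {p : ℕ} [Fact p.Prime] {M : MuTwoSetting p} (e : M.CLevelData)
  {E : M.toThetaSetting.EtaleThetaData} {l : ℕ} (C : E.DoubleUnderline l) {N : ℕ+}
  (μ : M.toThetaSetting.CyclotomeMod l N) (hC : M.toThetaSetting.Compat) (hS : M.toThetaSetting.Sec2Hyps)
  (hl : l.Prime) (hp2 : p ≠ 2) (hpl : p ≠ l) (hζ : ∃ ζ : M.toThetaSetting.K, IsPrimitiveRoot ζ (4 * l))
  {η : (C.thetaEnvData μ hC hS).PiYdd → MuN p N} (hη : η ∈ (C.thetaEnvData μ hC hS).thetaCocycles)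
  {Q : Type} [Group Q] [TopologicalSpace Q] [IsTopologicalGroup Q]
  (ι : M.GtpC →ₜ* Q) (hι : IsProfiniteCompletion ι) (hinj : Function.Injective ι)
  (Φ : Q →* GQp p) (hΦ : ∀ g : M.GtpC, Φ (ι g) = e.augC g) (hΦK : Φ.range = M.GK)
  (hZ : Thm16Sub.KerToZIsCompactlyGenerated M.toThetaSetting) (hN : (C.Huu.subgroupOf (M.GtpXu l)).Normal)
  {P : TopGroup.{0}} (T : TemperedCoverings (BadPlaceSetting.ofUnderline C μ hC hS hl hp2 hpl hζ hη) P)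

/-! ### §1. Vacuity of the typed node statement over the containment-keyed datum -/

/-- **VACUITY CERTIFICATE for IUTchII:Cor2.4(ii)(iii)′ at `ofCoverModel` over the CONTAINMENT-keyed datum** (kurims p. 70; Def. 2.3 (ii)
p. 68): with p430433's characterisation `hchar` and p442973's (h1)–(h4), `Cor24_ii_iii' W Cu H` holds for EVERY `H` — with no Cor. 2.4 (i),
no (S)/(E), no cusp clause — since all its clauses quantify over the EMPTY family `{I // Cu.IsCuspidalInertia Π_v I}`
(`isEmpty_cuspidalInertia_piV_of_containment`).  PROVED.  Reading: at that datum the typed statement is content-free; vacuously-true ≠ covered.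
[claim: Mochizuki2012, status: disputed] (IUTchII §2 Cor 2.4 (ii) p.70) -/
theorem cor24_ii_iii'_ofCoverModel_of_containment
    (Cu : CuspidalInertiaData (ofCoverModel e C μ hC hS hl hp2 hpl hζ hη ι hι hinj Φ hΦ hΦK hZ hN T))
    (hchar : ∀ Q' J : Subgroup (ofCoverModel e C μ hC hS hl hp2 hpl hζ hη ι hι hinj Φ hΦ hΦK hZ hN T).Corhat,
      Cu.IsCuspidalInertia Q' J ↔ J ≤ Q' ∧ ∃ i : {x : M.Pt // M.IsCusp x} × M.GtpC,
        ∃ t ∈ (ofCoverModel e C μ hC hS hl hp2 hpl hζ hη ι hι hinj Φ hΦ hΦK hZ hN T).piPM,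
          J = MulAut.conj t •
            (((MulAut.conj i.2 • (M.toTemperedCurve.inertia i.1.1).map M.inclX) ⊓ (M.GtpXu l).map M.inclX).map
              ι.toMonoidHom :
              Subgroup (ofCoverModel e C μ hC hS hl hp2 hpl hζ hη ι hι hinj Φ hΦ hΦK hZ hN T).Corhat))
    (h1 : ∀ x : M.Pt, M.IsCusp x →
      (M.toTemperedCurve.inertia x).map M.toThetaSetting.toTheta = M.toThetaSetting.DeltaTheta)
    (h2 : ∀ x : M.Pt, M.IsCusp x → M.toTemperedCurve.inertia x ≤ M.GtpXu l)
    (h3 : ∀ (g : M.GtpC) (x : M.Pt), M.IsCusp x → ∃ x' : M.Pt, M.IsCusp x' ∧ ∃ γ : M.PiTemp,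
      MulAut.conj g • (M.toTemperedCurve.inertia x).map M.inclX =
        (MulAut.conj γ • M.toTemperedCurve.inertia x').map M.inclX)
    (h4 : M.toThetaSetting.lDeltaTheta l ≠ M.toThetaSetting.DeltaTheta) (H : Subgroup P) :
    Literature.IUT.HodgeArakelov.Cor24_ii_iii' (ofCoverModel e C μ hC hS hl hp2 hpl hζ hη ι hι hinj Φ hΦ hΦK hZ hN T) Cu H := by
  haveI := isEmpty_cuspidalInertia_piV_of_containment e C μ hC hS hl hp2 hpl hζ hη ι hι hinj Φ hΦ hΦK hZ hN T Cu hchar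
    h1 h2 h3 h4
  rw [cor24_ii_iii'_iff]
  intro I hI
  exact (IsEmpty.false (⟨I, hI⟩ :
    {J // Cu.IsCuspidalInertia (ofCoverModel e C μ hC hS hl hp2 hpl hζ hη ι hι hinj Φ hΦ hΦK hZ hN T).piV J})).elim

/-! ### §2. The assembly over an intersection-keyed datum -/

/-- **IUTchII:Cor2.4(ii)(iii)′ at `ofCoverModel`, ASSEMBLED over ANY INTERSECTION-keyed datum `Ci`** (kurims p. 70; Def. 2.3 (ii) p. 68):
`Cor24_ii_iii' W Ci H` from ⟨node Cor. 2.4 (i) at `Ci` (`h24i`); (S) `Π^±_{v□} ↠ G_v` relative to `Π_v` (`hsurj`); (E) `Π^±_{v□} ∩ Π_v ⊆ Π_{v□}`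
(`hcap`); the [SemiAnbd]/[EtTh]-side statement `hX` of the (a.2) producer⟩, all hypotheses.  PROVED (`cor24_ii_iii'_of_inputs` ∘
`cuspDecomp_one_le_map_YddL_ofCoverModel_of_inter_of_piTemp`). [claim: Mochizuki2012, status: disputed] (IUTchII §2 Cor 2.4 (ii) p.70) -/
theorem cor24_ii_iii'_ofCoverModel_of_inter_of_piTemp
    (Ci : CuspidalInertiaData (ofCoverModel e C μ hC hS hl hp2 hpl hζ hη ι hι hinj Φ hΦ hΦK hZ hN T))
    (hint : ∀ I : Subgroup (ofCoverModel e C μ hC hS hl hp2 hpl hζ hη ι hι hinj Φ hΦ hΦK hZ hN T).Corhat,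
      Ci.IsCuspidalInertia (ofCoverModel e C μ hC hS hl hp2 hpl hζ hη ι hι hinj Φ hΦ hΦK hZ hN T).piV I →
        ∃ i : {x : M.Pt // M.IsCusp x} × M.GtpC,
          ∃ t ∈ (ofCoverModel e C μ hC hS hl hp2 hpl hζ hη ι hι hinj Φ hΦ hΦK hZ hN T).piPM,
            I = (MulAut.conj t •
              (((MulAut.conj i.2 • (M.toTemperedCurve.inertia i.1.1).map M.inclX) ⊓ (M.GtpXu l).map M.inclX).map
                ι.toMonoidHom :
                Subgroup (ofCoverModel e C μ hC hS hl hp2 hpl hζ hη ι hι hinj Φ hΦ hΦK hZ hN T).Corhat)) ⊓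
              (ofCoverModel e C μ hC hS hl hp2 hpl hζ hη ι hι hinj Φ hΦ hΦK hZ hN T).piV)
    (H : Subgroup P)
    (h24i : ∀ I : Subgroup (ofCoverModel e C μ hC hS hl hp2 hpl hζ hη ι hι hinj Φ hΦ hΦK hZ hN T).Corhat,
      Ci.IsCuspidalInertia (ofCoverModel e C μ hC hS hl hp2 hpl hζ hη ι hι hinj Φ hΦ hΦK hZ hN T).piV I →
        I ≤ (ofCoverModel e C μ hC hS hl hp2 hpl hζ hη ι hι hinj Φ hΦ hΦK hZ hN T).deltaBox H →
          Literature.IUT.HodgeArakelov.Cor24_i (ofCoverModel e C μ hC hS hl hp2 hpl hζ hη ι hι hinj Φ hΦ hΦK hZ hN T) Ci H I)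
    (hsurj : ∀ n : (ofCoverModel e C μ hC hS hl hp2 hpl hζ hη ι hι hinj Φ hΦ hΦK hZ hN T).Corhat,
      n ∈ (ofCoverModel e C μ hC hS hl hp2 hpl hζ hη ι hι hinj Φ hΦ hΦK hZ hN T).piV →
        ∃ m : (ofCoverModel e C μ hC hS hl hp2 hpl hζ hη ι hι hinj Φ hΦ hΦK hZ hN T).Corhat,
          m ∈ (ofCoverModel e C μ hC hS hl hp2 hpl hζ hη ι hι hinj Φ hΦ hΦK hZ hN T).pmBox H ∧
            m⁻¹ * n ∈ (ofCoverModel e C μ hC hS hl hp2 hpl hζ hη ι hι hinj Φ hΦ hΦK hZ hN T).aug.ker)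
    (hcap : (ofCoverModel e C μ hC hS hl hp2 hpl hζ hη ι hι hinj Φ hΦ hΦK hZ hN T).pmBox H ⊓
        (ofCoverModel e C μ hC hS hl hp2 hpl hζ hη ι hι hinj Φ hΦ hΦK hZ hN T).piV ≤
      (ofCoverModel e C μ hC hS hl hp2 hpl hζ hη ι hι hinj Φ hΦ hΦK hZ hN T).box H)
    (hX : ∀ (x : M.Pt), M.IsCusp x → ∀ (g t₁ : M.GtpC), t₁ ∈ (M.GtpXu l).map M.inclX →
      ∀ n₀ : M.PiTemp, n₀ ∈ C.Huu →
        (∀ h : M.GtpC, h ∈ (C.Huu : Subgroup M.PiTemp).map M.inclX →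
          (h ∈ MulAut.conj t₁ •
              ((MulAut.conj g • (M.toTemperedCurve.inertia x).map M.inclX) ⊓ (M.GtpXu l).map M.inclX) ↔
            M.inclX n₀ * h * (M.inclX n₀)⁻¹ ∈ MulAut.conj t₁ •
              ((MulAut.conj g • (M.toTemperedCurve.inertia x).map M.inclX) ⊓ (M.GtpXu l).map M.inclX))) →
        n₀ ∈ M.GtpYdd) :
    Literature.IUT.HodgeArakelov.Cor24_ii_iii' (ofCoverModel e C μ hC hS hl hp2 hpl hζ hη ι hι hinj Φ hΦ hΦK hZ hN T) Ci H :=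
  cor24_ii_iii'_of_inputs h24i hsurj hcap
    (cuspDecomp_one_le_map_YddL_ofCoverModel_of_inter_of_piTemp e C μ hC hS hl hp2 hpl hζ hη ι hι hinj Φ hΦ hΦK hZ hN T
      Ci hint hX H)

/-- **IUTchII:Cor2.4(ii)(iii)′ at `ofCoverModel` over ANY INTERSECTION-keyed datum, DISCHARGED MODULO THE NAMED INPUTS** ⟨node Cor. 2.4 (i)
(`h24i`); (S) `hsurj`; (E) `hcap`; F-1704 `habs`; F-1708 `hcomm`; cusp-splitting «`D_x ⊆ Π^tp_{Y₂}`» (`hsplit`, G-w6d069-1 at `N = 2`)⟩ — the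
lineage's rule-(3) residual list, now over a family that is inhabited (§3).  PROVED. [claim: Mochizuki2012, status: disputed] (IUTchII §2 Cor 2.4 (ii) p.70) -/
theorem cor24_ii_iii'_ofCoverModel_of_inter
    (Ci : CuspidalInertiaData (ofCoverModel e C μ hC hS hl hp2 hpl hζ hη ι hι hinj Φ hΦ hΦK hZ hN T))
    (hint : ∀ I : Subgroup (ofCoverModel e C μ hC hS hl hp2 hpl hζ hη ι hι hinj Φ hΦ hΦK hZ hN T).Corhat,
      Ci.IsCuspidalInertia (ofCoverModel e C μ hC hS hl hp2 hpl hζ hη ι hι hinj Φ hΦ hΦK hZ hN T).piV I →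
        ∃ i : {x : M.Pt // M.IsCusp x} × M.GtpC,
          ∃ t ∈ (ofCoverModel e C μ hC hS hl hp2 hpl hζ hη ι hι hinj Φ hΦ hΦK hZ hN T).piPM,
            I = (MulAut.conj t •
              (((MulAut.conj i.2 • (M.toTemperedCurve.inertia i.1.1).map M.inclX) ⊓ (M.GtpXu l).map M.inclX).map
                ι.toMonoidHom :
                Subgroup (ofCoverModel e C μ hC hS hl hp2 hpl hζ hη ι hι hinj Φ hΦ hΦK hZ hN T).Corhat)) ⊓
              (ofCoverModel e C μ hC hS hl hp2 hpl hζ hη ι hι hinj Φ hΦ hΦK hZ hN T).piV)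
    (H : Subgroup P)
    (h24i : ∀ I : Subgroup (ofCoverModel e C μ hC hS hl hp2 hpl hζ hη ι hι hinj Φ hΦ hΦK hZ hN T).Corhat,
      Ci.IsCuspidalInertia (ofCoverModel e C μ hC hS hl hp2 hpl hζ hη ι hι hinj Φ hΦ hΦK hZ hN T).piV I →
        I ≤ (ofCoverModel e C μ hC hS hl hp2 hpl hζ hη ι hι hinj Φ hΦ hΦK hZ hN T).deltaBox H →
          Literature.IUT.HodgeArakelov.Cor24_i (ofCoverModel e C μ hC hS hl hp2 hpl hζ hη ι hι hinj Φ hΦ hΦK hZ hN T) Ci H I)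
    (hsurj : ∀ n : (ofCoverModel e C μ hC hS hl hp2 hpl hζ hη ι hι hinj Φ hΦ hΦK hZ hN T).Corhat,
      n ∈ (ofCoverModel e C μ hC hS hl hp2 hpl hζ hη ι hι hinj Φ hΦ hΦK hZ hN T).piV →
        ∃ m : (ofCoverModel e C μ hC hS hl hp2 hpl hζ hη ι hι hinj Φ hΦ hΦK hZ hN T).Corhat,
          m ∈ (ofCoverModel e C μ hC hS hl hp2 hpl hζ hη ι hι hinj Φ hΦ hΦK hZ hN T).pmBox H ∧
            m⁻¹ * n ∈ (ofCoverModel e C μ hC hS hl hp2 hpl hζ hη ι hι hinj Φ hΦ hΦK hZ hN T).aug.ker)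
    (hcap : (ofCoverModel e C μ hC hS hl hp2 hpl hζ hη ι hι hinj Φ hΦ hΦK hZ hN T).pmBox H ⊓
        (ofCoverModel e C μ hC hS hl hp2 hpl hζ hη ι hι hinj Φ hΦ hΦK hZ hN T).piV ≤
      (ofCoverModel e C μ hC hS hl hp2 hpl hζ hη ι hι hinj Φ hΦ hΦK hZ hN T).box H)
    (habs : M.toTemperedCurve.IsoPreservesCuspidalDecomp M.toTemperedCurve)
    (hcomm : M.toTemperedCurve.DecompEqCommensuratorOfOpenInertia)
    (hsplit : ∀ x : M.Pt, M.IsCusp x → M.decomp x ≤ M.GtpYN 2) :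
    Literature.IUT.HodgeArakelov.Cor24_ii_iii' (ofCoverModel e C μ hC hS hl hp2 hpl hζ hη ι hι hinj Φ hΦ hΦK hZ hN T) Ci H :=
  cor24_ii_iii'_of_inputs h24i hsurj hcap
    (cuspDecomp_one_le_map_YddL_ofCoverModel_of_inter e C μ hC hS hl hp2 hpl hζ hη ι hι hinj Φ hΦ hΦK hZ hN T Ci hint habs hcomm
      hsplit H)

/-- **IUTchII:Cor2.4(ii)(iii)′ at `ofCoverModel` over ANY INTERSECTION-keyed datum, from the REGISTERED origin inputs** ⟨node Cor. 2.4 (i)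
(`h24i`); (S) `hsurj`; (E) `hcap`; F-1704 `habs`; F-1708 `hcomm`; `IsThm16Origin` R2 (F-3213) `hO` + (P3) `OncePuncturedData` `eO`⟩.  PROVED.
[claim: Mochizuki2012, status: disputed] (IUTchII §2 Cor 2.4 (ii) p.70) -/
theorem cor24_ii_iii'_ofCoverModel_of_inter_of_origin
    (Ci : CuspidalInertiaData (ofCoverModel e C μ hC hS hl hp2 hpl hζ hη ι hι hinj Φ hΦ hΦK hZ hN T))
    (hint : ∀ I : Subgroup (ofCoverModel e C μ hC hS hl hp2 hpl hζ hη ι hι hinj Φ hΦ hΦK hZ hN T).Corhat,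
      Ci.IsCuspidalInertia (ofCoverModel e C μ hC hS hl hp2 hpl hζ hη ι hι hinj Φ hΦ hΦK hZ hN T).piV I →
        ∃ i : {x : M.Pt // M.IsCusp x} × M.GtpC,
          ∃ t ∈ (ofCoverModel e C μ hC hS hl hp2 hpl hζ hη ι hι hinj Φ hΦ hΦK hZ hN T).piPM,
            I = (MulAut.conj t •
              (((MulAut.conj i.2 • (M.toTemperedCurve.inertia i.1.1).map M.inclX) ⊓ (M.GtpXu l).map M.inclX).map
                ι.toMonoidHom :
                Subgroup (ofCoverModel e C μ hC hS hl hp2 hpl hζ hη ι hι hinj Φ hΦ hΦK hZ hN T).Corhat)) ⊓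
              (ofCoverModel e C μ hC hS hl hp2 hpl hζ hη ι hι hinj Φ hΦ hΦK hZ hN T).piV)
    (H : Subgroup P)
    (h24i : ∀ I : Subgroup (ofCoverModel e C μ hC hS hl hp2 hpl hζ hη ι hι hinj Φ hΦ hΦK hZ hN T).Corhat,
      Ci.IsCuspidalInertia (ofCoverModel e C μ hC hS hl hp2 hpl hζ hη ι hι hinj Φ hΦ hΦK hZ hN T).piV I →
        I ≤ (ofCoverModel e C μ hC hS hl hp2 hpl hζ hη ι hι hinj Φ hΦ hΦK hZ hN T).deltaBox H →
          Literature.IUT.HodgeArakelov.Cor24_i (ofCoverModel e C μ hC hS hl hp2 hpl hζ hη ι hι hinj Φ hΦ hΦK hZ hN T) Ci H I)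
    (hsurj : ∀ n : (ofCoverModel e C μ hC hS hl hp2 hpl hζ hη ι hι hinj Φ hΦ hΦK hZ hN T).Corhat,
      n ∈ (ofCoverModel e C μ hC hS hl hp2 hpl hζ hη ι hι hinj Φ hΦ hΦK hZ hN T).piV →
        ∃ m : (ofCoverModel e C μ hC hS hl hp2 hpl hζ hη ι hι hinj Φ hΦ hΦK hZ hN T).Corhat,
          m ∈ (ofCoverModel e C μ hC hS hl hp2 hpl hζ hη ι hι hinj Φ hΦ hΦK hZ hN T).pmBox H ∧
            m⁻¹ * n ∈ (ofCoverModel e C μ hC hS hl hp2 hpl hζ hη ι hι hinj Φ hΦ hΦK hZ hN T).aug.ker)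
    (hcap : (ofCoverModel e C μ hC hS hl hp2 hpl hζ hη ι hι hinj Φ hΦ hΦK hZ hN T).pmBox H ⊓
        (ofCoverModel e C μ hC hS hl hp2 hpl hζ hη ι hι hinj Φ hΦ hΦK hZ hN T).piV ≤
      (ofCoverModel e C μ hC hS hl hp2 hpl hζ hη ι hι hinj Φ hΦ hΦK hZ hN T).box H)
    (habs : M.toTemperedCurve.IsoPreservesCuspidalDecomp M.toTemperedCurve)
    (hcomm : M.toTemperedCurve.DecompEqCommensuratorOfOpenInertia)
    (hO : M.toThetaSetting.IsThm16Origin) (eO : M.toThetaSetting.OncePuncturedData) :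
    Literature.IUT.HodgeArakelov.Cor24_ii_iii' (ofCoverModel e C μ hC hS hl hp2 hpl hζ hη ι hι hinj Φ hΦ hΦK hZ hN T) Ci H :=
  cor24_ii_iii'_of_inputs h24i hsurj hcap
    (cuspDecomp_one_le_map_YddL_ofCoverModel_of_inter_of_origin e C μ hC hS hl hp2 hpl hζ hη ι hι hinj Φ hΦ hΦK hZ hN T Ci hint
      habs hcomm hO eO H)

/-! ### §3. An intersection-keyed datum on `ofCoverModel` exists and its `Π_v`-family is inhabited -/

/-- **Every member of the tempered cusp family lies in `Π^±_v = ι(inclX Π^tp_{X̲})`** (it is an intersection with `inclX Π^tp_{X̲}`,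
conjugated inside `Π^±_v`).  PROVED. [claim: Mochizuki2012, status: disputed] (IUTchII §2 Def 2.3 (i)(ii), kurims pp.67–68) -/
theorem cuspFamily_le_piPM_ofCoverModel (i : {x : M.Pt // M.IsCusp x} × M.GtpC)
    {t : (ofCoverModel e C μ hC hS hl hp2 hpl hζ hη ι hι hinj Φ hΦ hΦK hZ hN T).Corhat}
    (ht : t ∈ (ofCoverModel e C μ hC hS hl hp2 hpl hζ hη ι hι hinj Φ hΦ hΦK hZ hN T).piPM) :
    (MulAut.conj t •
        (((MulAut.conj i.2 • (M.toTemperedCurve.inertia i.1.1).map M.inclX) ⊓ (M.GtpXu l).map M.inclX).map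
          ι.toMonoidHom : Subgroup (ofCoverModel e C μ hC hS hl hp2 hpl hζ hη ι hι hinj Φ hΦ hΦK hZ hN T).Corhat)) ≤
      (ofCoverModel e C μ hC hS hl hp2 hpl hζ hη ι hι hinj Φ hΦ hΦK hZ hN T).piPM := by
  intro y hy
  have hle : (((MulAut.conj i.2 • (M.toTemperedCurve.inertia i.1.1).map M.inclX) ⊓ (M.GtpXu l).map M.inclX).map
      ι.toMonoidHom : Subgroup (ofCoverModel e C μ hC hS hl hp2 hpl hζ hη ι hι hinj Φ hΦ hΦK hZ hN T).Corhat) ≤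
      (ofCoverModel e C μ hC hS hl hp2 hpl hζ hη ι hι hinj Φ hΦ hΦK hZ hN T).piPM := by
    rw [piPM_ofCoverModel]
    exact Subgroup.map_mono inf_le_right
  rw [Subgroup.mem_smul_pointwise_iff_exists] at hy
  obtain ⟨s, hs, rfl⟩ := hy
  exact Subgroup.mul_mem _ (Subgroup.mul_mem _ ht (hle hs)) (Subgroup.inv_mem _ ht)

/-- **An INTERSECTION-keyed cusp datum EXISTS on `ofCoverModel`** — the `{Π_v ⊆ Π^±_v}` slice of print's Def. 2.3 (ii) recipe over the
tempered cusp family of `X̲_v` (constructed inside the proof; NOT an agreement of record): cuspidal in `Π^±_v` ⟺ a member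
`t·ι((g·inclX I_x·g⁻¹) ∩ inclX Π^tp_{X̲})·t⁻¹`; cuspidal in `Π_v` ⟺ a trace `(member) ∩ Π_v`; nothing cuspidal at other levels.  It obeys
`hint`, and its `Π_v`-family is INHABITED as soon as `X` has a cusp `x₀`.  PROVED. [claim: Mochizuki2012, status: disputed]
(IUTchII §2 Def 2.3 (ii), kurims p.68) -/
theorem exists_interKeyed_cuspidalInertiaData_ofCoverModel {x₀ : M.Pt} (hx₀ : M.IsCusp x₀) :
    ∃ Ci : CuspidalInertiaData (ofCoverModel e C μ hC hS hl hp2 hpl hζ hη ι hι hinj Φ hΦ hΦK hZ hN T),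
      (∀ Q' I : Subgroup (ofCoverModel e C μ hC hS hl hp2 hpl hζ hη ι hι hinj Φ hΦ hΦK hZ hN T).Corhat,
        Ci.IsCuspidalInertia Q' I ↔
          ∃ i : {x : M.Pt // M.IsCusp x} × M.GtpC,
            ∃ t ∈ (ofCoverModel e C μ hC hS hl hp2 hpl hζ hη ι hι hinj Φ hΦ hΦK hZ hN T).piPM,
              (Q' = (ofCoverModel e C μ hC hS hl hp2 hpl hζ hη ι hι hinj Φ hΦ hΦK hZ hN T).piPM ∧
                I = (MulAut.conj t •
                  (((MulAut.conj i.2 • (M.toTemperedCurve.inertia i.1.1).map M.inclX) ⊓ (M.GtpXu l).map M.inclX).map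
                    ι.toMonoidHom : Subgroup (ofCoverModel e C μ hC hS hl hp2 hpl hζ hη ι hι hinj Φ hΦ hΦK hZ hN T).Corhat))) ∨
              (Q' = (ofCoverModel e C μ hC hS hl hp2 hpl hζ hη ι hι hinj Φ hΦ hΦK hZ hN T).piV ∧
                I = (MulAut.conj t •
                  (((MulAut.conj i.2 • (M.toTemperedCurve.inertia i.1.1).map M.inclX) ⊓ (M.GtpXu l).map M.inclX).map
                    ι.toMonoidHom : Subgroup (ofCoverModel e C μ hC hS hl hp2 hpl hζ hη ι hι hinj Φ hΦ hΦK hZ hN T).Corhat)) ⊓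
                  (ofCoverModel e C μ hC hS hl hp2 hpl hζ hη ι hι hinj Φ hΦ hΦK hZ hN T).piV)) ∧
      (∀ I : Subgroup (ofCoverModel e C μ hC hS hl hp2 hpl hζ hη ι hι hinj Φ hΦ hΦK hZ hN T).Corhat,
        Ci.IsCuspidalInertia (ofCoverModel e C μ hC hS hl hp2 hpl hζ hη ι hι hinj Φ hΦ hΦK hZ hN T).piV I →
          ∃ i : {x : M.Pt // M.IsCusp x} × M.GtpC,
            ∃ t ∈ (ofCoverModel e C μ hC hS hl hp2 hpl hζ hη ι hι hinj Φ hΦ hΦK hZ hN T).piPM,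
              I = (MulAut.conj t •
                (((MulAut.conj i.2 • (M.toTemperedCurve.inertia i.1.1).map M.inclX) ⊓ (M.GtpXu l).map M.inclX).map
                  ι.toMonoidHom : Subgroup (ofCoverModel e C μ hC hS hl hp2 hpl hζ hη ι hι hinj Φ hΦ hΦK hZ hN T).Corhat)) ⊓
                (ofCoverModel e C μ hC hS hl hp2 hpl hζ hη ι hι hinj Φ hΦ hΦK hZ hN T).piV) ∧
      Nonempty {I // Ci.IsCuspidalInertia (ofCoverModel e C μ hC hS hl hp2 hpl hζ hη ι hι hinj Φ hΦ hΦK hZ hN T).piV I} := by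
  refine ⟨{ IsCuspidalInertia := fun Q' I => ∃ i : {x : M.Pt // M.IsCusp x} × M.GtpC,
              ∃ t ∈ (ofCoverModel e C μ hC hS hl hp2 hpl hζ hη ι hι hinj Φ hΦ hΦK hZ hN T).piPM,
              (Q' = (ofCoverModel e C μ hC hS hl hp2 hpl hζ hη ι hι hinj Φ hΦ hΦK hZ hN T).piPM ∧
                I = (MulAut.conj t •
                  (((MulAut.conj i.2 • (M.toTemperedCurve.inertia i.1.1).map M.inclX) ⊓ (M.GtpXu l).map M.inclX).map
                    ι.toMonoidHom : Subgroup (ofCoverModel e C μ hC hS hl hp2 hpl hζ hη ι hι hinj Φ hΦ hΦK hZ hN T).Corhat))) ∨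
              (Q' = (ofCoverModel e C μ hC hS hl hp2 hpl hζ hη ι hι hinj Φ hΦ hΦK hZ hN T).piV ∧
                I = (MulAut.conj t •
                  (((MulAut.conj i.2 • (M.toTemperedCurve.inertia i.1.1).map M.inclX) ⊓ (M.GtpXu l).map M.inclX).map
                    ι.toMonoidHom : Subgroup (ofCoverModel e C μ hC hS hl hp2 hpl hζ hη ι hι hinj Φ hΦ hΦK hZ hN T).Corhat)) ⊓
                  (ofCoverModel e C μ hC hS hl hp2 hpl hζ hη ι hι hinj Φ hΦ hΦK hZ hN T).piV)
            le_of_isCuspidalInertia := by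
              rintro Q' I ⟨i, t, ht, (⟨rfl, rfl⟩ | ⟨rfl, rfl⟩)⟩
              · exact cuspFamily_le_piPM_ofCoverModel e C μ hC hS hl hp2 hpl hζ hη ι hι hinj Φ hΦ hΦK hZ hN T i ht
              · exact inf_le_right }, fun Q' I => Iff.rfl, ?_, ?_⟩
  · rintro I ⟨i, t, ht, (⟨hQ, rfl⟩ | ⟨-, rfl⟩)⟩
    · -- `Π_v = Π^±_v` is not excluded by the typing; then the member is its own trace
      exact ⟨i, t, ht, (inf_eq_left.mpr
        ((cuspFamily_le_piPM_ofCoverModel e C μ hC hS hl hp2 hpl hζ hη ι hι hinj Φ hΦ hΦK hZ hN T i ht).trans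
          hQ.symm.le)).symm⟩
    · exact ⟨i, t, ht, rfl⟩
  · exact ⟨⟨_, ⟨⟨x₀, hx₀⟩, 1⟩, 1, Subgroup.one_mem _, Or.inr ⟨rfl, rfl⟩⟩⟩

end PlusMinusTower

end Literature.IUT.HodgeArakelov

end
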